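import Summits.BirchSwinnertonDyer.BirchSwinnertonDyer.Theorems.CyclotomicUntwistPSUntwistedTraceRootField
import Summits.BirchSwinnertonDyer.BirchSwinnertonDyer.Theorems.CyclotomicUntwistCoefficientField
import HarnessLib

/-!
# LAW L-a3 over the coefficient field `ℚ₃(ζ₃)`: under the clause `α² − a_w(W)·α + 3 = 0` the conjugate datum is
# EXPLICIT — `α = ι α_K`, `σ α_K = a_w − α_K`, `α_K · σ α_K = 3`, `α_K ≠ 0, 3` (route `CyclotomicUntwist`, K1 / K2)

Cell `pub/bsd-wall` (D-0145 line `route-BirchSwinnertonDyer-CyclotomicUntwist`), seat `bsd-line-cycu-p3` (gen 6).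
Helper toward K1 (stmt-BirchSwinnertonDyer-21580) / K2 (stmt-21581). THEOREMS ONLY (no definition, no named fact,
no `sorry`); BSD is not proved by this file and no crux is.

WHY. cycu-p5's conjugate-pair bookkeeping («one character of each pair {η, η̄} suffices»:
`CyclotomicUntwistConjugatePin.exists_pinned_transfer`, `pin_eq_conj_sq`, `ConjugateLFunctionsThree`) is stated over
`K = CyclotomicField 3 ℚ_[3]` with an automorphism `σ` and takes as HYPOTHESES `α = ι α_K`, `α_K ≠ 0`, `α_K ≠ 3` and
`α_K · σ α_K = 3`. For a datum satisfying the K-SEP′ clause `α² − a_w(W)·α + 3 = 0` (`a_w = W.psUntwistedTrace`,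
p616806) all of these are THEOREMS: `X² − a_w X + 3` has discriminant `a_w² − 12 ∈ {−12, −3}` (`a_w ∈ {0, ±3}`), its
roots are `(a_w ± m·√−3)/2` (`m ∈ {2, 1}`), `√−3 = 2ζ₃ + 1 ∈ K`, and cycu-p1's `σ` (`σ ζ₃ = ζ₃⁻¹`) negates `√−3`, hence
swaps the two roots.

* `exists_signed_preimage_root` — the root-field lemma of `…PSUntwistedTraceRootField` with the SIGN exposed:
  `x = ι((a + εδ)/2)`, `ε = ±1`;
* `exists_sigma_sqrt_neg_three` — in `K = CyclotomicField 3 ℚ_[3]`: `σ` with `σ z = z⁻¹` for `z³ = 1`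
  (`PSCoefficientField.exists_algEquiv_apply_eq_inv_of_pow_three`) and `δ₀ := 2ζ₃ + 1` with `δ₀² = −3`, `σ δ₀ = −δ₀`;
* **`exists_conj_datum_of_clause`** — for `ι : K →ₐ[ℚ₃] ℂ₃` and `α² − a_w(W)·α + 3 = 0`: there are `σ` (inverting cube
  roots of unity, so `η_K.ringHomComp σ = η_K⁻¹` for every `η_K³ = 1` or `η_K⁶ = 1` by the cycu-p1/p5 lemmas) and `α_K ∈ K` with
  `ι α_K = α`, `α_K² − a_w α_K + 3 = 0`, **`σ α_K = a_w − α_K`**, **`α_K · σ α_K = 3`**, `α_K ≠ 0`, `α_K ≠ 3`.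

References: B. Mazur, J. Tate, J. Teitelbaum, Invent. Math. 84 (1986) §I.10, §I.14 [MazurTateTeitelbaum1986Invent];
D. Benois, *p-adic heights and p-adic Hodge theory*, Mém. SMF 167 (2020) §0.3 [Benois2020]; A. Kraus, Manuscripta Math. 69 (1990) [Kraus1990].
-/

set_option autoImplicit false
-- single-conjunct summit: `Summit.BirchSwinnertonDyer.BirchSwinnertonDyer.…` repeats the name by design
set_option linter.dupNamespace false

noncomputable section

namespace Summit.BirchSwinnertonDyer.BirchSwinnertonDyer.Theorems.PSUntwistedTrace

/-! ### The signed root-field lemma -/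

/-- `exists_preimage_root` with the sign exposed: for fields `K`, `F` with `(2 : F) ≠ 0`, `ι : K →+* F`, `δ ∈ K` with
`δ² = a² − 12`, every root `x ∈ F` of `X² − ι(a)X + 3` is `ι((a + εδ)/2)` for some `ε = ±1`. [folklore] -/
theorem exists_signed_preimage_root {K F : Type*} [Field K] [Field F] (ι : K →+* F) (h2 : (2 : F) ≠ 0) {a δ : K}
    (hδ : δ ^ 2 = a ^ 2 - 12) {x : F} (h : x ^ 2 - ι a * x + 3 = 0) :
    ∃ ε : K, (ε = 1 ∨ ε = -1) ∧ ι ((a + ε * δ) / 2) = x := by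
  have hιδ : (ι δ) ^ 2 = (ι a) ^ 2 - 12 := by
    rw [← map_pow, hδ, map_sub, map_pow, map_ofNat]
  have hsq : (2 * x - ι a) ^ 2 = (ι δ) ^ 2 := by rw [hιδ]; exact sq_two_mul_sub_eq h
  rcases sq_eq_sq_iff_eq_or_eq_neg.mp hsq with hx | hx
  · refine ⟨1, Or.inl rfl, ?_⟩
    rw [one_mul, map_div₀, map_add, map_ofNat, div_eq_iff h2]
    linear_combination -hx
  · refine ⟨-1, Or.inr rfl, ?_⟩
    rw [neg_one_mul, ← sub_eq_add_neg, map_div₀, map_sub, map_ofNat, div_eq_iff h2]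
    linear_combination -hx

/-! ### `√−3 = 2ζ₃ + 1 ∈ ℚ₃(ζ₃)` and its conjugation -/

/-- In `K = ℚ₃(ζ₃)`: cycu-p1's conjugation `σ` (`σ z = z⁻¹` whenever `z³ = 1`) and `δ₀ := 2ζ₃ + 1` with `δ₀² = −3` and
`σ δ₀ = −δ₀`. [folklore] -/
theorem exists_sigma_sqrt_neg_three :
    ∃ (σ : CyclotomicField 3 ℚ_[3] ≃ₐ[ℚ_[3]] CyclotomicField 3 ℚ_[3]) (δ₀ : CyclotomicField 3 ℚ_[3]),
      (∀ z : CyclotomicField 3 ℚ_[3], z ^ 3 = 1 → σ z = z⁻¹) ∧ δ₀ ^ 2 = -3 ∧ σ δ₀ = -δ₀ := by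
  obtain ⟨σ, hσ⟩ := PSCoefficientField.exists_algEquiv_apply_eq_inv_of_pow_three
  set L := CyclotomicField 3 ℚ_[3]
  have hζ : IsPrimitiveRoot (IsCyclotomicExtension.zeta 3 ℚ_[3] L) 3 := IsCyclotomicExtension.zeta_spec 3 ℚ_[3] L
  set ζ := IsCyclotomicExtension.zeta 3 ℚ_[3] L with hζdef
  have hζ3 : ζ ^ 3 = 1 := hζ.pow_eq_one
  have hζ1 : ζ ≠ 1 := hζ.ne_one (by norm_num)
  -- `ζ² + ζ + 1 = 0`
  have hquad : ζ ^ 2 + ζ + 1 = 0 := by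
    have hfac : (ζ - 1) * (ζ ^ 2 + ζ + 1) = 0 := by linear_combination hζ3
    rcases mul_eq_zero.mp hfac with h | h
    · exact absurd (sub_eq_zero.mp h) hζ1
    · exact h
  have hζ0 : ζ ≠ 0 := fun h ↦ by rw [h] at hζ3; norm_num at hζ3
  -- `σ ζ = ζ⁻¹ = ζ²`
  have hσζ : σ ζ = ζ ^ 2 := by
    rw [hσ ζ hζ3]
    exact inv_eq_of_mul_eq_one_right (by linear_combination hζ3)
  refine ⟨σ, 2 * ζ + 1, hσ, by linear_combination 4 * hquad, ?_⟩
  rw [map_add, map_mul, map_ofNat, map_one, hσζ]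
  linear_combination 2 * hquad

/-! ### The conjugate datum under the clause -/

/-- **Under the K-SEP′ clause the conjugate datum is explicit.** For `ι : ℚ₃(ζ₃) →ₐ[ℚ₃] ℂ₃` and `α ∈ ℂ₃` with
`α² − a_w(W)·α + 3 = 0`: there are a conjugation `σ` of `ℚ₃(ζ₃)` inverting the cube roots of unity (hence
`η_K.ringHomComp σ = η_K⁻¹` for every character with `η_K³ = 1` / `η_K⁶ = 1`, cycu-p1 / cycu-p5) and `α_K ∈ ℚ₃(ζ₃)` with
`ι α_K = α`, `α_K² − a_w(W)·α_K + 3 = 0`, `σ α_K = a_w(W) − α_K`, `α_K · σ α_K = 3`, `α_K ≠ 0` and `α_K ≠ 3` — the four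
hypotheses of `CyclotomicUntwistConjugatePin.exists_pinned_transfer` / `pin_eq_conj_sq` about `α_K`, discharged.
[cite: MazurTateTeitelbaum1986Invent, §I.10 and §I.14] [cite: Benois2020, §0.3] -/
theorem exists_conj_datum_of_clause (ι : CyclotomicField 3 ℚ_[3] →ₐ[ℚ_[3]] ℂ_[3]) {W : WeierstrassCurve ℚ} {α : ℂ_[3]}
    (h : α ^ 2 - ((W.psUntwistedTrace : ℤ) : ℂ_[3]) * α + 3 = 0) :
    ∃ (σ : CyclotomicField 3 ℚ_[3] ≃ₐ[ℚ_[3]] CyclotomicField 3 ℚ_[3]) (αK : CyclotomicField 3 ℚ_[3]),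
      (∀ z : CyclotomicField 3 ℚ_[3], z ^ 3 = 1 → σ z = z⁻¹) ∧
      ι αK = α ∧ αK ^ 2 - ((W.psUntwistedTrace : ℤ) : CyclotomicField 3 ℚ_[3]) * αK + 3 = 0 ∧
      σ αK = ((W.psUntwistedTrace : ℤ) : CyclotomicField 3 ℚ_[3]) - αK ∧ αK * σ αK = 3 ∧ αK ≠ 0 ∧
      αK ≠ 3 := by
  obtain ⟨σ, δ₀, hσ, hδ₀, hσδ₀⟩ := exists_sigma_sqrt_neg_three
  obtain ⟨a, ha⟩ : ∃ a : CyclotomicField 3 ℚ_[3], a = ((W.psUntwistedTrace : ℤ) : CyclotomicField 3 ℚ_[3]) :=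
    ⟨_, rfl⟩
  rw [← ha]
  have hιa : (ι : CyclotomicField 3 ℚ_[3] →+* ℂ_[3]) a = ((W.psUntwistedTrace : ℤ) : ℂ_[3]) := by
    rw [ha, map_intCast]
  have h' : α ^ 2 - (ι : CyclotomicField 3 ℚ_[3] →+* ℂ_[3]) a * α + 3 = 0 := by rw [hιa]; exact h
  have hσa : σ a = a := by rw [ha, map_intCast]
  -- a square root `δ` of `a² − 12` with `σ δ = −δ`: `δ = 2δ₀` (`a = 0`) or `δ = δ₀` (`a = ±3`)
  obtain ⟨δ, hδ, hσδ⟩ : ∃ δ : CyclotomicField 3 ℚ_[3], δ ^ 2 = a ^ 2 - 12 ∧ σ δ = -δ := by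
    rcases psUntwistedTrace_eq_or W with h0 | h0 | h0
    · refine ⟨2 * δ₀, ?_, by rw [map_mul, map_ofNat, hσδ₀]; ring⟩
      rw [ha, h0]; push_cast; linear_combination 4 * hδ₀
    · refine ⟨δ₀, ?_, hσδ₀⟩
      rw [ha, h0]; push_cast; linear_combination hδ₀
    · refine ⟨δ₀, ?_, hσδ₀⟩
      rw [ha, h0]; push_cast; linear_combination hδ₀
  obtain ⟨ε, hε, hx⟩ := exists_signed_preimage_root (ι : CyclotomicField 3 ℚ_[3] →+* ℂ_[3]) two_ne_zero hδ h'
  have hε2 : ε ^ 2 = 1 := by rcases hε with rfl | rfl <;> norm_num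
  have hσε : σ ε = ε := by rcases hε with rfl | rfl <;> simp
  have hσroot : σ ((a + ε * δ) / 2) = (a - ε * δ) / 2 := by
    rw [map_div₀, map_add, map_mul, map_ofNat, hσa, hσε, hσδ]; ring
  refine ⟨σ, (a + ε * δ) / 2, hσ, hx, ?_, ?_, ?_, ?_, ?_⟩
  · -- the root equation in `K`
    have e : ((a + ε * δ) / 2) ^ 2 - a * ((a + ε * δ) / 2) + 3 = (ε ^ 2 * δ ^ 2 - (a ^ 2 - 12)) / 4 := by ring
    rw [e, hε2, one_mul, hδ, sub_self, zero_div]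
  · -- `σ` swaps the roots
    rw [hσroot]; ring
  · -- product of the roots
    rw [hσroot]
    have e : (a + ε * δ) / 2 * ((a - ε * δ) / 2) = (a ^ 2 - ε ^ 2 * δ ^ 2) / 4 := by ring
    rw [e, hε2, one_mul, hδ]; ring
  · -- `α_K ≠ 0`
    intro h0
    have hα0 : α = 0 := by rw [← hx, h0, map_zero]
    rw [hα0] at h; norm_num at h
  · -- `α_K ≠ 3`: otherwise `12 − 3a_w = 0`, impossible for `a_w ∈ {0, ±3}`
    intro h3
    have hα3 : α = 3 := by rw [← hx, h3, map_ofNat]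
    rw [hα3] at h
    rcases psUntwistedTrace_eq_or W with h0 | h0 | h0 <;> rw [h0] at h <;> norm_num at h

end Summit.BirchSwinnertonDyer.BirchSwinnertonDyer.Theorems.PSUntwistedTrace

end
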